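import Summits.AtomisticToContinuum.BoseEinsteinCondensation.Theses.BECDensityChord
import Literature.MathematicalPhysics.QuantumManyBody.JelliumBoseGasCondensateDilation

/-!
# Crux `DepletionStarShaped` (stmt-AtomisticToContinuum-11554) — strategist census, Lean side

Machine-checked facts used by `STRATEGY-CENSUS.md` (BC2-redirect re-audit of route BECDensityChord):

* `secant_occupation` — ONE instance of the secant inequality at a pair of densities `(ρ, ρ')`,
  `0 ≤ ρ`, `0 < ρ'`, already gives `λ_max ≥ (1 - (ρ/ρ')^{1/3}) N` at density `ρ`.
* `CofinalFragment` / `boseEinsteinCondensation_of_cofinal` — hence ANY fragment of the crux that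
  still offers, for every small density, one strictly larger partner density with an eventual-in-`N`
  secant is already at least the conjunct `BoseEinsteinCondensation`.
* The candidate pieces of the regime / locality / threshold splits (`BulkStarShaped`,
  `LocalStarShaped`, `PointwiseStarShaped`) and the crux itself are such fragments:
  `…_implies_BEC` (landed `C → S` theorems = BC2 signal "summit-or-harder" for these pieces).
* `WindowStarShaped` (bounded GP parameter) is the complementary piece; it is NOT a cofinal
  fragment (its densities vanish as `N → ∞`).
* Proved glues / equivalences used by the census table: `depletionStarShaped_of_window_bulk` (D1),
  `localStarShaped_iff` (D2: the adjacent-pair fragment IS the crux), `depletionStarShaped_of_classes`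
  (D4: one-line seam), `depletionStarShaped_of_window_doubling` (D5: dyadic induction),
  `convexBridge_conditionalBEC` (D6-i), `cN_scalePotential` (the fixed-`N` density axis is the
  dilation family, `JelliumBoseGas.condensateNumber_dilate`).
-/

noncomputable section

namespace Summit.AtomisticToContinuum.BoseEinsteinCondensation.Cruxes.DepletionStarShaped.Census

open Literature.MathematicalPhysics.QuantumManyBody.BoseGas
open Summit.AtomisticToContinuum.BoseEinsteinCondensation.Theses.BECDensityChord
open Filter Topology
open scoped ENNReal

/-- Condensate number `λ_max(γ_{Ψ₀})` of the `N`-particle Dirichlet ground state at density `ρ`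
(box side `(N/ρ)^{1/3}`). -/
abbrev cN (v : ℝ → ℝ≥0∞) (N : ℕ) (ρ : ℝ) : ℝ≥0∞ :=
  condensateNumber v N (sideLength ρ N)

/-- One instance of the secant ("star-shape") inequality at particle number `N` and densities
`ρ₁ ≤ ρ₂`: `ρ₂^{1/3} N + ρ₁^{1/3} cN(ρ₂) ≤ ρ₁^{1/3} N + ρ₂^{1/3} cN(ρ₁)`, i.e.
`D(ρ₁)/ρ₁^{1/3} ≤ D(ρ₂)/ρ₂^{1/3}` with `D = N - cN` (subtraction-free form, verbatim the body of
`DepletionStarShaped`). -/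
def Secant (v : ℝ → ℝ≥0∞) (N : ℕ) (ρ₁ ρ₂ : ℝ) : Prop :=
  ENNReal.ofReal (ρ₂ ^ (1 / 3 : ℝ)) * (N : ℝ≥0∞) + ENNReal.ofReal (ρ₁ ^ (1 / 3 : ℝ)) * cN v N ρ₂ ≤
    ENNReal.ofReal (ρ₁ ^ (1 / 3 : ℝ)) * (N : ℝ≥0∞) + ENNReal.ofReal (ρ₂ ^ (1 / 3 : ℝ)) * cN v N ρ₁

/-- The crux, restated through `Secant` (definitional). -/
theorem depletionStarShaped_iff :
    DepletionStarShaped ↔ ∀ v : ℝ → ℝ≥0∞, IsRepulsiveFiniteRange v → ∃ ρs : ℝ, 0 < ρs ∧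
      ∀ᶠ N : ℕ in atTop, ∀ ρ₁ ρ₂ : ℝ, 0 < ρ₁ → ρ₁ ≤ ρ₂ → ρ₂ ≤ ρs → Secant v N ρ₁ ρ₂ :=
  Iff.rfl

/-- **One secant instance is a BEC bound.** If the secant inequality holds at `(ρ, ρ')` with
`0 ≤ ρ`, `0 < ρ'`, then `λ_max ≥ (1 - (ρ/ρ')^{1/3}) · N` at density `ρ` (only `cN(ρ') ≥ 0` is used). -/
theorem secant_occupation {v : ℝ → ℝ≥0∞} {N : ℕ} {ρ ρ' : ℝ} (hρ : 0 ≤ ρ) (hρ' : 0 < ρ')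
    (h : Secant v N ρ ρ') :
    ENNReal.ofReal ((1 - (ρ / ρ') ^ (1 / 3 : ℝ)) * N) ≤ cN v N ρ := by
  have h1 : ENNReal.ofReal (ρ' ^ (1 / 3 : ℝ)) * (N : ℝ≥0∞) ≤
      ENNReal.ofReal (ρ ^ (1 / 3 : ℝ)) * (N : ℝ≥0∞) + ENNReal.ofReal (ρ' ^ (1 / 3 : ℝ)) * cN v N ρ :=
    le_trans le_self_add h
  rcases eq_or_ne (cN v N ρ) ⊤ with htop | hfin
  · rw [htop]; exact le_top
  · set c : ℝ≥0∞ := cN v N ρ with hc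
    have t'pos : 0 < ρ' ^ (1 / 3 : ℝ) := Real.rpow_pos_of_pos hρ' _
    have tnn : 0 ≤ ρ ^ (1 / 3 : ℝ) := Real.rpow_nonneg hρ _
    have hA : ENNReal.ofReal (ρ' ^ (1 / 3 : ℝ)) * (N : ℝ≥0∞) ≠ ⊤ :=
      ENNReal.mul_ne_top ENNReal.ofReal_ne_top (ENNReal.natCast_ne_top N)
    have hB : ENNReal.ofReal (ρ ^ (1 / 3 : ℝ)) * (N : ℝ≥0∞) ≠ ⊤ :=
      ENNReal.mul_ne_top ENNReal.ofReal_ne_top (ENNReal.natCast_ne_top N)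
    have hC : ENNReal.ofReal (ρ' ^ (1 / 3 : ℝ)) * c ≠ ⊤ := ENNReal.mul_ne_top ENNReal.ofReal_ne_top hfin
    have h2 : ρ' ^ (1 / 3 : ℝ) * N ≤ ρ ^ (1 / 3 : ℝ) * N + ρ' ^ (1 / 3 : ℝ) * c.toReal := by
      have h3 := (ENNReal.toReal_le_toReal hA (ENNReal.add_ne_top.2 ⟨hB, hC⟩)).2 h1
      rw [ENNReal.toReal_add hB hC, ENNReal.toReal_mul, ENNReal.toReal_mul, ENNReal.toReal_mul,
        ENNReal.toReal_ofReal t'pos.le, ENNReal.toReal_ofReal tnn, ENNReal.toReal_natCast] at h3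
      exact h3
    have key : (1 - (ρ / ρ') ^ (1 / 3 : ℝ)) * N ≤ c.toReal := by
      rw [Real.div_rpow hρ hρ'.le]
      have e : (1 - ρ ^ (1 / 3 : ℝ) / ρ' ^ (1 / 3 : ℝ)) * N =
          (ρ' ^ (1 / 3 : ℝ) * N - ρ ^ (1 / 3 : ℝ) * N) / ρ' ^ (1 / 3 : ℝ) := by
        field_simp
      rw [e, div_le_iff₀ t'pos]
      nlinarith [h2, t'pos.le]
    calc ENNReal.ofReal ((1 - (ρ / ρ') ^ (1 / 3 : ℝ)) * N)
        ≤ ENNReal.ofReal c.toReal := ENNReal.ofReal_le_ofReal key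
      _ = c := ENNReal.ofReal_toReal hfin

/-- A **cofinal fragment** of the star-shape statement for one potential `v`: every density in a
window `(0, ρs)` has SOME strictly larger partner density at which the secant holds for all large
`N` (threshold may depend on the pair). -/
def CofinalFragment (v : ℝ → ℝ≥0∞) : Prop :=
  ∃ ρs : ℝ, 0 < ρs ∧ ∀ ρ : ℝ, 0 < ρ → ρ < ρs → ∃ ρ' : ℝ, ρ < ρ' ∧ ∀ᶠ N : ℕ in atTop, Secant v N ρ ρ'

/-- A cofinal fragment already gives ground-state BEC at every density of its window, with the
explicit chord constant `c(ρ) = 1 - (ρ/ρ')^{1/3} > 0`. -/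
theorem hasGroundStateBEC_of_cofinalFragment {v : ℝ → ℝ≥0∞} (h : CofinalFragment v) :
    ∃ ρ₀ : ℝ, 0 < ρ₀ ∧ ∀ ρ : ℝ, 0 < ρ → ρ < ρ₀ → HasGroundStateBEC v ρ := by
  obtain ⟨ρs, hρs, H⟩ := h
  refine ⟨ρs, hρs, fun ρ hρ hρlt => ?_⟩
  obtain ⟨ρ', hρρ', hN⟩ := H ρ hρ hρlt
  have hρ'pos : 0 < ρ' := hρ.trans hρρ'
  refine ⟨1 - (ρ / ρ') ^ (1 / 3 : ℝ), ?_, ?_⟩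
  · have h1 : (ρ / ρ') ^ (1 / 3 : ℝ) < 1 :=
      Real.rpow_lt_one (div_nonneg hρ.le hρ'pos.le) ((div_lt_one hρ'pos).2 hρρ') (by norm_num)
    linarith
  · filter_upwards [hN] with N hN'
    exact secant_occupation hρ.le hρ'pos hN'

/-- **Any statement that supplies a cofinal fragment for every admissible potential is at least
the conjunct.** This is the mechanism behind the judge's `smuggling` flag, in checkable form. -/
theorem boseEinsteinCondensation_of_cofinal
    (h : ∀ v : ℝ → ℝ≥0∞, IsRepulsiveFiniteRange v → CofinalFragment v) :
    _root_.BoseEinsteinCondensation :=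
  fun v hv => hasGroundStateBEC_of_cofinalFragment (h v hv)

/-! ## Candidate pieces of the attempted decompositions (signatures) -/

/-- D1, bulk piece: the secant only ABOVE an `N`-dependent density floor tending to `0`
(the regime `κ = aN^{2/3}ρ^{1/3} ≥ κ₁`, i.e. `ρ ≥ κ₁³/(a³N²)`; any floor sequence allowed). -/
def BulkStarShaped : Prop :=
  ∀ v : ℝ → ℝ≥0∞, IsRepulsiveFiniteRange v → ∃ ρs : ℝ, 0 < ρs ∧ ∃ floor : ℕ → ℝ,
    Tendsto floor atTop (𝓝 0) ∧ ∀ᶠ N : ℕ in atTop, ∀ ρ₁ ρ₂ : ℝ,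
      floor N ≤ ρ₁ → 0 < ρ₁ → ρ₁ ≤ ρ₂ → ρ₂ ≤ ρs → Secant v N ρ₁ ρ₂

/-- D1, window piece: the secant only BELOW every ceiling `C/N²` (bounded GP parameter: the
Gross–Pitaevskii window and the perturbative onset). Not a cofinal fragment. -/
def WindowStarShaped : Prop :=
  ∀ v : ℝ → ℝ≥0∞, IsRepulsiveFiniteRange v → ∀ C : ℝ, 0 < C → ∀ᶠ N : ℕ in atTop, ∀ ρ₁ ρ₂ : ℝ,
    0 < ρ₁ → ρ₁ ≤ ρ₂ → ρ₂ ≤ C / (N : ℝ) ^ 2 → Secant v N ρ₁ ρ₂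

/-- D2, local piece: the secant only for ADJACENT pairs `ρ₂ ≤ 2ρ₁`. -/
def LocalStarShaped : Prop :=
  ∀ v : ℝ → ℝ≥0∞, IsRepulsiveFiniteRange v → ∃ ρs : ℝ, 0 < ρs ∧ ∀ᶠ N : ℕ in atTop, ∀ ρ₁ ρ₂ : ℝ,
    0 < ρ₁ → ρ₁ ≤ ρ₂ → ρ₂ ≤ 2 * ρ₁ → ρ₂ ≤ ρs → Secant v N ρ₁ ρ₂

/-- D3, pointwise-threshold piece: the `N`-threshold may depend on the pair of densities. -/
def PointwiseStarShaped : Prop :=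
  ∀ v : ℝ → ℝ≥0∞, IsRepulsiveFiniteRange v → ∃ ρs : ℝ, 0 < ρs ∧ ∀ ρ₁ ρ₂ : ℝ,
    0 < ρ₁ → ρ₁ ≤ ρ₂ → ρ₂ ≤ ρs → ∀ᶠ N : ℕ in atTop, Secant v N ρ₁ ρ₂

/-! ## The crux and the pieces D1-bulk, D2, D3 are cofinal fragments, hence `≥` the conjunct -/

theorem cofinal_of_depletionStarShaped (h : DepletionStarShaped) :
    ∀ v : ℝ → ℝ≥0∞, IsRepulsiveFiniteRange v → CofinalFragment v := by
  intro v hv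
  obtain ⟨ρs, hρs, hN⟩ := h v hv
  refine ⟨ρs, hρs, fun ρ hρ hρlt => ⟨ρs, hρlt, ?_⟩⟩
  filter_upwards [hN] with N hN'
  exact hN' ρ ρs hρ hρlt.le le_rfl

theorem cofinal_of_bulkStarShaped (h : BulkStarShaped) :
    ∀ v : ℝ → ℝ≥0∞, IsRepulsiveFiniteRange v → CofinalFragment v := by
  intro v hv
  obtain ⟨ρs, hρs, floor, hfloor, hN⟩ := h v hv
  refine ⟨ρs, hρs, fun ρ hρ hρlt => ⟨ρs, hρlt, ?_⟩⟩
  have hfl : ∀ᶠ N : ℕ in atTop, floor N < ρ := hfloor.eventually_mem (Iio_mem_nhds hρ)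
  filter_upwards [hN, hfl] with N hN' hfl'
  exact hN' ρ ρs hfl'.le hρ hρlt.le le_rfl

theorem cofinal_of_localStarShaped (h : LocalStarShaped) :
    ∀ v : ℝ → ℝ≥0∞, IsRepulsiveFiniteRange v → CofinalFragment v := by
  intro v hv
  obtain ⟨ρs, hρs, hN⟩ := h v hv
  refine ⟨ρs, hρs, fun ρ hρ hρlt => ⟨min (2 * ρ) ρs, lt_min (by linarith) hρlt, ?_⟩⟩
  filter_upwards [hN] with N hN'
  exact hN' ρ _ hρ (le_min (by linarith) hρlt.le) (min_le_left _ _) (min_le_right _ _)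

theorem cofinal_of_pointwiseStarShaped (h : PointwiseStarShaped) :
    ∀ v : ℝ → ℝ≥0∞, IsRepulsiveFiniteRange v → CofinalFragment v := by
  intro v hv
  obtain ⟨ρs, hρs, hN⟩ := h v hv
  exact ⟨ρs, hρs, fun ρ hρ hρlt => ⟨ρs, hρlt, hN ρ ρs hρ hρlt.le le_rfl⟩⟩

/-- The crux is at least the conjunct (the `SecantLemma ∘ closes` path, self-contained). -/
theorem depletionStarShaped_implies_BEC (h : DepletionStarShaped) : _root_.BoseEinsteinCondensation :=
  boseEinsteinCondensation_of_cofinal (cofinal_of_depletionStarShaped h)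

/-- D1's bulk piece alone is at least the conjunct (BC2 (c) fails for it). -/
theorem bulkStarShaped_implies_BEC (h : BulkStarShaped) : _root_.BoseEinsteinCondensation :=
  boseEinsteinCondensation_of_cofinal (cofinal_of_bulkStarShaped h)

/-- D2's local piece alone is at least the conjunct (BC2 (c) fails for it). -/
theorem localStarShaped_implies_BEC (h : LocalStarShaped) : _root_.BoseEinsteinCondensation :=
  boseEinsteinCondensation_of_cofinal (cofinal_of_localStarShaped h)

/-- D3's pointwise-threshold piece alone is at least the conjunct (BC2 (c) fails for it). -/
theorem pointwiseStarShaped_implies_BEC (h : PointwiseStarShaped) : _root_.BoseEinsteinCondensation :=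
  boseEinsteinCondensation_of_cofinal (cofinal_of_pointwiseStarShaped h)


/-! ## D1 in full: the regime split `Window ∧ Bulk → crux` with a PROVED, non-trivial glue

The glue is genuine (`D/t` non-decreasing is transitive through the junction density `C/N²`,
including the `⊤` bookkeeping of `ℝ≥0∞`), so D1 satisfies (a) and (b); it fails (c) because the
bulk piece is a cofinal fragment (`bulkStarShaped'_implies_BEC`). -/

/-- Transitivity of the secant through an intermediate density: unconditional in `ℝ≥0∞`. -/
theorem secant_trans {v : ℝ → ℝ≥0∞} {N : ℕ} {ρ₁ ρm ρ₂ : ℝ} (h₁ : 0 < ρ₁) (hm : 0 < ρm)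
    (h₂ : 0 < ρ₂) (hA : Secant v N ρ₁ ρm) (hB : Secant v N ρm ρ₂) : Secant v N ρ₁ ρ₂ := by
  unfold Secant at hA hB ⊢
  have hapos : 0 < ρ₁ ^ (1 / 3 : ℝ) := Real.rpow_pos_of_pos h₁ _
  have hbpos : 0 < ρm ^ (1 / 3 : ℝ) := Real.rpow_pos_of_pos hm _
  have hcpos : 0 < ρ₂ ^ (1 / 3 : ℝ) := Real.rpow_pos_of_pos h₂ _
  set a : ℝ≥0∞ := ENNReal.ofReal (ρ₁ ^ (1 / 3 : ℝ)) with ha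
  set b : ℝ≥0∞ := ENNReal.ofReal (ρm ^ (1 / 3 : ℝ)) with hb
  set c : ℝ≥0∞ := ENNReal.ofReal (ρ₂ ^ (1 / 3 : ℝ)) with hc
  set x : ℝ≥0∞ := cN v N ρ₁ with hx
  set y : ℝ≥0∞ := cN v N ρm with hy
  set z : ℝ≥0∞ := cN v N ρ₂ with hz
  have ha0 : a ≠ 0 := (ENNReal.ofReal_pos.2 hapos).ne'
  have hb0 : b ≠ 0 := (ENNReal.ofReal_pos.2 hbpos).ne'
  have hc0 : c ≠ 0 := (ENNReal.ofReal_pos.2 hcpos).ne'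
  have haT : a ≠ ⊤ := ENNReal.ofReal_ne_top
  have hbT : b ≠ ⊤ := ENNReal.ofReal_ne_top
  have hcT : c ≠ ⊤ := ENNReal.ofReal_ne_top
  have hNT : (N : ℝ≥0∞) ≠ ⊤ := ENNReal.natCast_ne_top N
  -- ⊤ bookkeeping
  by_cases hxT : x = ⊤
  · have : c * x = ⊤ := by rw [hxT]; exact ENNReal.mul_top hc0
    rw [this, add_top]; exact le_top
  by_cases hyT : y = ⊤
  · exfalso
    apply hxT
    have h' : a * y = ⊤ := by rw [hyT]; exact ENNReal.mul_top ha0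
    have htop : a * (N : ℝ≥0∞) + b * x = ⊤ :=
      top_unique (le_trans (le_of_eq (by rw [h', add_top])) hA)
    rcases ENNReal.add_eq_top.1 htop with h | h
    · exact absurd h (ENNReal.mul_ne_top haT hNT)
    · rcases ENNReal.mul_eq_top.1 h with h | h
      · exact h.2
      · exact absurd h.1 hbT
  by_cases hzT : z = ⊤
  · exfalso
    apply hyT
    have h' : b * z = ⊤ := by rw [hzT]; exact ENNReal.mul_top hb0
    have htop : b * (N : ℝ≥0∞) + c * y = ⊤ :=
      top_unique (le_trans (le_of_eq (by rw [h', add_top])) hB)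
    rcases ENNReal.add_eq_top.1 htop with h | h
    · exact absurd h (ENNReal.mul_ne_top hbT hNT)
    · rcases ENNReal.mul_eq_top.1 h with h | h
      · exact h.2
      · exact absurd h.1 hcT
  -- all finite: pass to reals
  have fin : ∀ {p q : ℝ≥0∞}, p ≠ ⊤ → q ≠ ⊤ → p * q ≠ ⊤ := fun hp hq => ENNReal.mul_ne_top hp hq
  have hA' := (ENNReal.toReal_le_toReal (ENNReal.add_ne_top.2 ⟨fin hbT hNT, fin haT hyT⟩)
    (ENNReal.add_ne_top.2 ⟨fin haT hNT, fin hbT hxT⟩)).2 hA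
  have hB' := (ENNReal.toReal_le_toReal (ENNReal.add_ne_top.2 ⟨fin hcT hNT, fin hbT hzT⟩)
    (ENNReal.add_ne_top.2 ⟨fin hbT hNT, fin hcT hyT⟩)).2 hB
  rw [← ENNReal.toReal_le_toReal (ENNReal.add_ne_top.2 ⟨fin hcT hNT, fin haT hzT⟩)
    (ENNReal.add_ne_top.2 ⟨fin haT hNT, fin hcT hxT⟩)]
  rw [ENNReal.toReal_add (fin hbT hNT) (fin haT hyT), ENNReal.toReal_add (fin haT hNT) (fin hbT hxT)]
    at hA'
  rw [ENNReal.toReal_add (fin hcT hNT) (fin hbT hzT), ENNReal.toReal_add (fin hbT hNT) (fin hcT hyT)]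
    at hB'
  rw [ENNReal.toReal_add (fin hcT hNT) (fin haT hzT), ENNReal.toReal_add (fin haT hNT) (fin hcT hxT)]
  simp only [ENNReal.toReal_mul, ENNReal.toReal_natCast, ha, hb, hc,
    ENNReal.toReal_ofReal hapos.le, ENNReal.toReal_ofReal hbpos.le, ENNReal.toReal_ofReal hcpos.le]
    at hA' hB' ⊢
  -- hA' : tm N + t₁ y ≤ t₁ N + tm x ; hB' : t₂ N + tm z ≤ tm N + t₂ y ; goal : t₂ N + t₁ z ≤ t₁ N + t₂ x
  have e1 := mul_le_mul_of_nonneg_left hA' hcpos.le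
  have e2 := mul_le_mul_of_nonneg_left hB' hapos.le
  have key : ρm ^ (1 / 3 : ℝ) * (ρ₂ ^ (1 / 3 : ℝ) * N + ρ₁ ^ (1 / 3 : ℝ) * z.toReal) ≤
      ρm ^ (1 / 3 : ℝ) * (ρ₁ ^ (1 / 3 : ℝ) * N + ρ₂ ^ (1 / 3 : ℝ) * x.toReal) := by
    nlinarith [e1, e2]
  exact le_of_mul_le_mul_left key hbpos

/-- D1, bulk piece in the form that meets the window: the secant above the floor `C/N²` for SOME
`C > 0` (a special case of `BulkStarShaped`). -/
def BulkStarShaped' : Prop :=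
  ∀ v : ℝ → ℝ≥0∞, IsRepulsiveFiniteRange v → ∃ C : ℝ, 0 < C ∧ ∃ ρs : ℝ, 0 < ρs ∧
    ∀ᶠ N : ℕ in atTop, ∀ ρ₁ ρ₂ : ℝ, C / (N : ℝ) ^ 2 ≤ ρ₁ → 0 < ρ₁ → ρ₁ ≤ ρ₂ → ρ₂ ≤ ρs →
      Secant v N ρ₁ ρ₂

theorem bulkStarShaped_of_bulkStarShaped' (h : BulkStarShaped') : BulkStarShaped := by
  intro v hv
  obtain ⟨C, hC, ρs, hρs, hN⟩ := h v hv
  refine ⟨ρs, hρs, fun N => C / (N : ℝ) ^ 2, ?_, hN⟩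
  have h2 : Tendsto (fun N : ℕ => ((N : ℝ) ^ 2)⁻¹) atTop (𝓝 0) := by
    have := (tendsto_pow_atTop (α := ℝ) two_ne_zero).comp tendsto_natCast_atTop_atTop
    exact this.inv_tendsto_atTop
  simpa [div_eq_mul_inv] using h2.const_mul C

/-- … hence the bulk piece of D1 is, alone, at least the conjunct: (c) fails for D1. -/
theorem bulkStarShaped'_implies_BEC (h : BulkStarShaped') : _root_.BoseEinsteinCondensation :=
  bulkStarShaped_implies_BEC (bulkStarShaped_of_bulkStarShaped' h)

/-- … and the bulk piece of D1. -/
theorem bulkStarShaped'_of_depletionStarShaped (h : DepletionStarShaped) : BulkStarShaped' := by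
  intro v hv
  obtain ⟨ρs, hρs, hN⟩ := h v hv
  refine ⟨1, one_pos, ρs, hρs, ?_⟩
  filter_upwards [hN] with N hN' ρ₁ ρ₂ _ h1 h12 h2s
  exact hN' ρ₁ ρ₂ h1 h12 h2s

/-- **D1 glue (proved, non-trivial):** window piece ∧ bulk piece ⟹ the crux, by transitivity of
`D/t`-monotonicity through the junction density `C/N²`. -/
theorem depletionStarShaped_of_window_bulk (hW : WindowStarShaped) (hB : BulkStarShaped') :
    DepletionStarShaped := by
  intro v hv
  obtain ⟨C, hC, ρs, hρs, hN⟩ := hB v hv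
  refine ⟨ρs, hρs, ?_⟩
  have hW' := hW v hv C hC
  have hNpos : ∀ᶠ N : ℕ in atTop, 0 < C / (N : ℝ) ^ 2 := by
    filter_upwards [eventually_gt_atTop 0] with N hN0
    exact div_pos hC (pow_pos (Nat.cast_pos.2 hN0) 2)
  filter_upwards [hN, hW', hNpos] with N hBN hWN hmN
  intro ρ₁ ρ₂ h1 h12 h2s
  rcases le_or_gt ρ₂ (C / (N : ℝ) ^ 2) with hlow | hhigh
  · exact hWN ρ₁ ρ₂ h1 h12 hlow
  rcases le_or_gt (C / (N : ℝ) ^ 2) ρ₁ with hup | hstr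
  · exact hBN ρ₁ ρ₂ hup h1 h12 h2s
  -- straddling pair: chain through the junction density
  exact secant_trans h1 hmN (h1.trans_le h12)
    (hWN ρ₁ _ h1 hstr.le le_rfl) (hBN _ ρ₂ le_rfl hmN hhigh.le h2s)

/-! ## D2 in full: the locality split is vacuous — the adjacent-pair fragment IS the crux

Chaining adjacent pairs through the geometric ladder `ρ₁, 2ρ₁, 4ρ₁, …` (all inside one eventual
set in `N`) recovers every pair, so `LocalStarShaped ↔ DepletionStarShaped`: (c) fails maximally. -/

theorem depletionStarShaped_of_localStarShaped (h : LocalStarShaped) : DepletionStarShaped := by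
  intro v hv
  obtain ⟨ρs, hρs, hN⟩ := h v hv
  refine ⟨ρs, hρs, ?_⟩
  filter_upwards [hN] with N hL
  have P : ∀ k : ℕ, ∀ ρ₁ ρ₂ : ℝ, 0 < ρ₁ → ρ₁ ≤ ρ₂ → ρ₂ ≤ (2 : ℝ) ^ k * ρ₁ → ρ₂ ≤ ρs →
      Secant v N ρ₁ ρ₂ := by
    intro k
    induction k with
    | zero =>
      intro ρ₁ ρ₂ h1 h12 h2 h2s
      exact hL ρ₁ ρ₂ h1 h12 (by simp at h2; linarith) h2s
    | succ k ih =>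
      intro ρ₁ ρ₂ h1 h12 h2 h2s
      rcases le_or_gt ρ₂ (2 * ρ₁) with hA | hB
      · exact hL ρ₁ ρ₂ h1 h12 hA h2s
      · have e : (2 : ℝ) ^ (k + 1) * ρ₁ = (2 : ℝ) ^ k * (2 * ρ₁) := by ring
        exact secant_trans h1 (by linarith) (h1.trans_le h12)
          (hL ρ₁ (2 * ρ₁) h1 (by linarith) le_rfl (by linarith))
          (ih (2 * ρ₁) ρ₂ (by linarith) hB.le (by rw [e] at h2; exact h2) h2s)
  intro ρ₁ ρ₂ h1 h12 h2s
  obtain ⟨k, hk⟩ := pow_unbounded_of_one_lt (ρ₂ / ρ₁) (one_lt_two : (1 : ℝ) < 2)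
  have hk' : ρ₂ < (2 : ℝ) ^ k * ρ₁ := by rwa [div_lt_iff₀ h1] at hk
  exact P k ρ₁ ρ₂ h1 h12 hk'.le h2s

/-- `LocalStarShaped` is literally equivalent to the crux. -/
theorem localStarShaped_iff : LocalStarShaped ↔ DepletionStarShaped := by
  refine ⟨depletionStarShaped_of_localStarShaped, fun h v hv => ?_⟩
  obtain ⟨ρs, hρs, hN⟩ := h v hv
  refine ⟨ρs, hρs, ?_⟩
  filter_upwards [hN] with N hN' ρ₁ ρ₂ h1 h12 _ h2s
  exact hN' ρ₁ ρ₂ h1 h12 h2s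

/-- The crux trivially gives the pointwise-threshold piece (D3) … -/
theorem pointwiseStarShaped_of_depletionStarShaped (h : DepletionStarShaped) :
    PointwiseStarShaped := by
  intro v hv
  obtain ⟨ρs, hρs, hN⟩ := h v hv
  refine ⟨ρs, hρs, fun ρ₁ ρ₂ h1 h12 h2s => ?_⟩
  filter_upwards [hN] with N hN'
  exact hN' ρ₁ ρ₂ h1 h12 h2s

/-! ## D4: splitting over classes of potentials is a trivial seam ((b) fails)

For ANY predicate `P` on potentials the two restricted cruxes reassemble by a one-line case split;
so a `v`-class split (hard core / soft core, integrable / not, …) never qualifies, independently of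
the fact that each class-restricted piece is the same open problem for that class. -/

/-- The crux restricted to a class of potentials. -/
def StarShapedOn (P : (ℝ → ℝ≥0∞) → Prop) : Prop :=
  ∀ v : ℝ → ℝ≥0∞, P v → IsRepulsiveFiniteRange v → ∃ ρs : ℝ, 0 < ρs ∧
    ∀ᶠ N : ℕ in atTop, ∀ ρ₁ ρ₂ : ℝ, 0 < ρ₁ → ρ₁ ≤ ρ₂ → ρ₂ ≤ ρs → Secant v N ρ₁ ρ₂

/-- The one-line seam. -/
theorem depletionStarShaped_of_classes (P : (ℝ → ℝ≥0∞) → Prop) (h₁ : StarShapedOn P)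
    (h₂ : StarShapedOn fun v => ¬ P v) : DepletionStarShaped :=
  fun v hv => (em (P v)).elim (fun hP => h₁ v hP hv) (fun hP => h₂ v hP hv)

/-! ## D0: the route's own parent split `DensityConcavity ∧ DilutionAnchor → crux`

`ConcavityToSecant` (item stmt-…-11559) has refuter candidate proofs (rc 0) attached; composing it
with `depletionStarShaped_implies_BEC` exhibits `DensityConcavity` as summit-or-harder MODULO the
provable-now support `DilutionAnchor` — the reason D0 fails (c) in substance although both pieces
pass the cheap probes today. -/

theorem densityConcavity_anchor_implies_BEC (hCS : ConcavityToSecant) (hDC : DensityConcavity)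
    (hA : DilutionAnchor) : _root_.BoseEinsteinCondensation :=
  depletionStarShaped_implies_BEC (hCS hDC hA)

/-! ## D5: dyadic induction in the density — `Window ∧ Doubling → crux`

Formally the cleanest candidate: BOTH pieces are consequences of the crux
(`windowStarShaped_of_depletionStarShaped`, `doublingStep_of_depletionStarShaped`), NEITHER is a
cofinal fragment (the window lives below `C/N²`; the doubling step is an implication whose
antecedent is never discharged on its own), and the assembly below is a genuine induction over the
dyadic density scales `2^k/N²` (not a one-line seam). So D5 meets (a), (b) and the MECHANICAL form
of (c). It is nevertheless a costume of the crux: by the dilation identity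
`JelliumBoseGas.condensateNumber_dilate` (`cN_scalePotential` below) the antecedent of the doubling
step at scale `ρa` for `v` is the crux window `(0, 2ρa]` for the rescaled, shorter-range copy
`scalePotential 2^{-1/3} v`, so the step asserts that star-shape transfers from `v_{2^{-1/3}}` to
`v` on the same window — a monotonicity-in-the-potential claim for which no tool exists that is not
a proof of the crux itself (census §D5). Recorded so the human sees exactly how the mechanical
certificate can be met without an honest reduction. -/

/-- D5, step piece: star-shape on `(0, ρa]` propagates to `(0, 2ρa]` at the same `N`
(one `N`-threshold for all `ρa` with `2ρa ≤ ρ⋆`). -/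
def DoublingStep : Prop :=
  ∀ v : ℝ → ℝ≥0∞, IsRepulsiveFiniteRange v → ∃ ρs : ℝ, 0 < ρs ∧ ∀ᶠ N : ℕ in atTop, ∀ ρa : ℝ,
    0 < ρa → 2 * ρa ≤ ρs →
      (∀ ρ₁ ρ₂ : ℝ, 0 < ρ₁ → ρ₁ ≤ ρ₂ → ρ₂ ≤ ρa → Secant v N ρ₁ ρ₂) →
      ∀ ρ₁ ρ₂ : ℝ, 0 < ρ₁ → ρ₁ ≤ ρ₂ → ρ₂ ≤ 2 * ρa → Secant v N ρ₁ ρ₂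

/-- The crux gives the doubling step in one line (the antecedent is not even used). -/
theorem doublingStep_of_depletionStarShaped (h : DepletionStarShaped) : DoublingStep := by
  intro v hv
  obtain ⟨ρs, hρs, hN⟩ := h v hv
  refine ⟨ρs, hρs, ?_⟩
  filter_upwards [hN] with N hN' ρa _ h2 _ ρ₁ ρ₂ h1 h12 h22
  exact hN' ρ₁ ρ₂ h1 h12 (h22.trans h2)

/-- The crux gives the window piece (eventually `C/N² ≤ ρ⋆`). -/
theorem windowStarShaped_of_depletionStarShaped (h : DepletionStarShaped) : WindowStarShaped := by
  intro v hv C hC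
  obtain ⟨ρs, hρs, hN⟩ := h v hv
  have h2 : Tendsto (fun N : ℕ => C / (N : ℝ) ^ 2) atTop (𝓝 0) := by
    have h3 : Tendsto (fun N : ℕ => ((N : ℝ) ^ 2)⁻¹) atTop (𝓝 0) := by
      have := (tendsto_pow_atTop (α := ℝ) two_ne_zero).comp tendsto_natCast_atTop_atTop
      exact this.inv_tendsto_atTop
    simpa [div_eq_mul_inv] using h3.const_mul C
  filter_upwards [hN, h2.eventually (eventually_le_nhds hρs)] with N hN' hs ρ₁ ρ₂ h1 h12 h2C
  exact hN' ρ₁ ρ₂ h1 h12 (h2C.trans hs)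

/-- **D5 glue (proved): window ∧ doubling step ⟹ the crux (with `ρ⋆/2`)**, by induction over the
dyadic scales `2^k/N²` inside the common eventual set in `N`. -/
theorem depletionStarShaped_of_window_doubling (hW : WindowStarShaped) (hD : DoublingStep) :
    DepletionStarShaped := by
  intro v hv
  obtain ⟨ρs, hρs, hN⟩ := hD v hv
  refine ⟨ρs / 2, half_pos hρs, ?_⟩
  filter_upwards [hN, hW v hv 1 one_pos, eventually_gt_atTop 0] with N hDN hWN hN0
  have hNpos : (0 : ℝ) < N := Nat.cast_pos.2 hN0
  have hupos : 0 < 1 / (N : ℝ) ^ 2 := div_pos one_pos (pow_pos hNpos 2)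
  -- Q k : the secant for all pairs below the dyadic scale `2^k/N²` and below `ρ⋆/2`
  have Q : ∀ k : ℕ, ∀ ρ₁ ρ₂ : ℝ, 0 < ρ₁ → ρ₁ ≤ ρ₂ → ρ₂ ≤ (2 : ℝ) ^ k * (1 / (N : ℝ) ^ 2) →
      ρ₂ ≤ ρs / 2 → Secant v N ρ₁ ρ₂ := by
    intro k
    induction k with
    | zero =>
      intro ρ₁ ρ₂ h1 h12 h2 _
      exact hWN ρ₁ ρ₂ h1 h12 (by simpa using h2)
    | succ k ih =>
      intro ρ₁ ρ₂ h1 h12 h2 h2s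
      rcases le_or_gt ρ₂ ((2 : ℝ) ^ k * (1 / (N : ℝ) ^ 2)) with hA | hB
      · exact ih ρ₁ ρ₂ h1 h12 hA h2s
      · have hka : 0 < (2 : ℝ) ^ k * (1 / (N : ℝ) ^ 2) := by positivity
        have hks : 2 * ((2 : ℝ) ^ k * (1 / (N : ℝ) ^ 2)) ≤ ρs := by linarith
        have hyp : ∀ σ₁ σ₂ : ℝ, 0 < σ₁ → σ₁ ≤ σ₂ → σ₂ ≤ (2 : ℝ) ^ k * (1 / (N : ℝ) ^ 2) →
            Secant v N σ₁ σ₂ :=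
          fun σ₁ σ₂ g1 g12 g2 => ih σ₁ σ₂ g1 g12 g2 (by linarith)
        have e : (2 : ℝ) ^ (k + 1) * (1 / (N : ℝ) ^ 2) = 2 * ((2 : ℝ) ^ k * (1 / (N : ℝ) ^ 2)) := by
          ring
        exact hDN _ hka hks hyp ρ₁ ρ₂ h1 h12 (by rw [e] at h2; exact h2)
  intro ρ₁ ρ₂ h1 h12 h2
  obtain ⟨k, hk⟩ := pow_unbounded_of_one_lt (ρs / 2 / (1 / (N : ℝ) ^ 2)) (one_lt_two : (1 : ℝ) < 2)
  have hk' : ρs / 2 < (2 : ℝ) ^ k * (1 / (N : ℝ) ^ 2) := by rwa [div_lt_iff₀ hupos] at hk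
  exact Q k ρ₁ ρ₂ h1 h12 (h2.trans hk'.le) h2

/-- The dilation identity behind the costume verdict on D5 (and behind the fixed-`N` picture of the
whole route): the density family at fixed `N` is the range-dilation family of the potential,
`cN (s⁻²v(·/s)) N (ρ/s³) = cN v N ρ`. -/
theorem cN_scalePotential (v : ℝ → ℝ≥0∞) (N : ℕ) {ρ s : ℝ} (hρ : 0 < ρ) (hs : 0 < s) :
    cN (scalePotential s v) N (ρ / s ^ 3) = cN v N ρ := by
  unfold cN
  rw [Literature.MathematicalPhysics.QuantumManyBody.JelliumBoseGas.sideLength_div_pow_three hρ hs,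
    Literature.MathematicalPhysics.QuantumManyBody.JelliumBoseGas.condensateNumber_dilate v N _ hs]

/-! ## D6-i: the bridge through the torus Bogoliubov convexity hides `S` in the implication piece

The implication piece `BogoliubovDepletionConvex → DepletionStarShaped` of the modus-ponens split
delivers the conjunct outright the moment the (numerically certified, provable) lattice-sum
inequality is proved: it is `S` conditional on a computation, not a reduction of `S`. -/

theorem convexBridge_conditionalBEC (hBridge : BogoliubovDepletionConvex → DepletionStarShaped)
    (hT : BogoliubovDepletionConvex) : _root_.BoseEinsteinCondensation :=
  depletionStarShaped_implies_BEC (hBridge hT)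

/-- … and already its bulk half does (the window half is the only place the torus curve enters). -/
theorem convexBridge_bulk_conditionalBEC (hBulk : BogoliubovDepletionConvex → BulkStarShaped')
    (hT : BogoliubovDepletionConvex) : _root_.BoseEinsteinCondensation :=
  bulkStarShaped'_implies_BEC (hBulk hT)

end Summit.AtomisticToContinuum.BoseEinsteinCondensation.Cruxes.DepletionStarShaped.Census

end
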